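import Literature.MathematicalPhysics.QuantumLattice.FermionBoxProductMarginals
import HarnessLib

/-!
# Product states over a partition of `ℤ^d` into FINITE BLOCKS: the infinite product `⊗_i ρ_i` of even block
# density matrices (Araki–Moriya 2003, Theorem 11.2, finite-block version)

Topic `Literature/MathematicalPhysics/QuantumLattice` (namespace = path; family `hubbard`, model-free, general `d`).
`InfVolFermionStateProduct.lean` constructs the Araki–Moriya product of even infinite-volume states placed on the LEGS of a
tiling `K × ℤ^{d'} ≃ ℤ^d` (layers, sublattices); `FermionBoxProductMarginals.lean` is the finite-dimensional bookkeeping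
of products `Π_k Γ_{φ_k}(σ_k)` of even operators on boxes with disjoint images. This file is the remaining case the
Gibbs variational principle needs: the product state of the CAR algebra over `ℤ^d` obtained by placing an EVEN DENSITY
MATRIX `ρ_i ∈ 𝔄(B_i)` on every block `B_i` of a partition `ℤ^d = ⊔_i B_i` into FINITE blocks (e.g. the box tiling
`n·v + [0,n)^d`, `v ∈ ℤ^d`, with the box Gibbs state on every box). Locally, on a finite region `Λ`, its density matrix is
the box product `Π_{i ∈ classes(Λ)} Γ_{Λ ∩ B_i ⊆ Λ}(tr_{Λ ∩ B_i ⊆ B_i} ρ_i)` of the embedded block MARGINALS (even, hence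
commuting; positive; of trace one because the parts `Λ ∩ B_i` tile `Λ`).

* §1 `BlockPartition d ι` (class map `cls : ℤ^d → ι` with finite fibres `block i`), the parts `blockLoc Λ i = Λ ∩ B_i`,
  the classes met `blockClasses Λ`, the part embeddings `blockEmb Λ i : 𝔄(Λ ∩ B_i) → 𝔄(Λ)` (isotony) with pairwise
  disjoint images, `Σ_{i ∈ classes Λ} |Λ ∩ B_i| = |Λ|`.
* §2 the block marginals `blockMarginal ρ Λ i = tr_{Λ∩B_i ⊆ B_i} ρ_i` (even, positive, trace one; `= 𝟙` on an absent
  block) and the block values `blockVal ρ i hX b = tr(Γ_{X ⊆ B_i} b · ρ_i)` of an observable `b ∈ 𝔄(X)`, `X ⊆ B_i`.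
* §3 the local density `blockDensity ρ hρ Λ = Π_{i ∈ classes Λ} Γ (blockMarginal ρ Λ i)` (a `boxProd`): even, positive,
  **trace one**, unchanged by absent classes, and THE PRODUCT FORMULA
  `tr(blockDensity · Π_{i∈l} Γ_i b_i) = Π_{i∈l} blockVal ρ i b_i` (from `normTrace_boxProd_mul_prod` and the tiling count).
* §4 every word of `𝔄(Λ)` factors through the parts up to a sign; compatibility of the local functionals with isotony.
* §5 **`blockProductState P ρ hev hpsd htr : InfVolFermionState d`** — all four structure fields proved — with the
  product property (`blockProductState_expect_prod`), ONE BLOCK `ω(Γ_{X ⊆ Λ} b) = tr(Γ_{X ⊆ B_i} b · ρ_i)`, in particular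
  **`(blockProductState …).rdm (P.block i) = ρ i`** (the marginal on a block IS the block density matrix) and
  `rdm Λ = blockDensity Λ`; evenness; UNIQUENESS (`eq_blockProductState_of_forall_prod`).

Everything is PROVED (no `sorry`, no named fact). Definitions with bodies: `BlockPartition` (structure), `blockLoc`,
`blockClasses`, `blockEmb`, `blockMarginal`, `blockVal`, `blockDensity`, `blockExpect`, `InfVolFermionState.blockProductState`.
HONEST SCOPE: all block states even (as in Araki–Moriya Thm. 11.2 for translation purposes); translation covariance /
periodicity of box-tiling products and the entropy and energy of these states are the business of the sequel files
(`FermionBlockProductStateEntropy`, `FermionBoxTilingProductState`).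

## Tree / Mathlib search

REUSED: `boxProd`, `boxProd_insert/_eq_mul_erase/_empty`, `parityAut_boxProd`, `posSemidef_boxProd`, `normTrace_boxProd`,
`normTrace_boxProd_mul_prod` (`FermionBoxProductMarginals`); `normTrace`, `wordOp_eq_sign_smul_prod_filter`,
`eq_of_forall_trace_mul_eq` (`InfVolFermionStateProduct`); `fermionPartialTrace` + `trace_mul_fermionPartialTrace`,
`posSemidef_/trace_/parityAut_fermionPartialTrace(_of_even)`, `fermionPartialTrace_trans` (`FermionPartialTrace`);
`fermionEmbed` functoriality, `PolySite.incl`, `InfVolFermionState.rdm/trace_rdm_mul` (`InfVolFermionState`);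
`mem_span_wordOp_of_mem_carSubalgebra`, `carSubalgebra_univ_eq_top`, `fermionEmbed_letterOp`; Mathlib
`Finset.card_eq_sum_card_image`. `lean search 'blockProduct|boxTiling.*State|productState.*box'` (2026-08-28): nothing
for finite blocks (only the leg product `InfVolFermionState.productState`).

## References

* H. Araki, H. Moriya, *Equilibrium statistical mechanics of Fermion lattice systems*, Rev. Math. Phys. 15 (2003) 93,
  §11.1 Lemma 11.1 and **Theorem 11.2** (product state extension of even states of disjoint regions: `φ(A) = τ(ρ A)`,
  `ρ = ρ_n ⋯ ρ_1`, product property (11.4), uniqueness), §4.1 (local algebras, `Θ`, the tracial state).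
  [cite: ArakiMoriya2003, §11.1 Theorem 11.2]
* O. Bratteli, D. W. Robinson, *OAQSM 2* (1997), §5.2.2 (CAR algebra, graded commutation), Prop. 6.2.38 / Thm. 6.2.40
  (product states over box tilings in the proof of the variational principle). [cite: BratteliRobinsonII1997, Thm. 6.2.40]
* O. Bratteli, D. W. Robinson, *OAQSM 1* (1987), §2.6 (density matrices of locally normal states). [cite: BratteliRobinsonI1987, §2.6]
-/

noncomputable section

namespace Literature.MathematicalPhysics.QuantumLattice

open Matrix Finset HubbardWave0 Literature.Probability.LatticeModels
open scoped ComplexOrder BigOperators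

/-! ### §1. Partitions of `ℤ^d` into finite blocks -/

/-- **A partition of `ℤ^d` into finite blocks**: a class map `cls : ℤ^d → ι` whose fibres are the finite regions
`block i` (`x ∈ block i ↔ cls x = i`). Examples: the box tiling `n·v + [0,n)^d` (`ι = ℤ^d`), any superlattice cell
decomposition. (Araki–Moriya's "mutually disjoint finite regions `I_i`", here exhausting the lattice.)
[cite: ArakiMoriya2003, §11.1 Theorem 11.2] -/
structure BlockPartition (d : ℕ) (ι : Type*) where
  /-- The block index of a site. -/
  cls : Site d → ι
  /-- The block with index `i`, a finite region. -/
  block : ι → Finset (Site d)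
  /-- The blocks are the fibres of the class map. -/
  mem_block_iff : ∀ (i : ι) (x : Site d), x ∈ block i ↔ cls x = i

namespace BlockPartition

variable {d : ℕ} {ι : Type*} (P : BlockPartition d ι)

/-- A site lies in its own block. [cite: ArakiMoriya2003, §11.1] -/
theorem mem_block_cls (x : Site d) : x ∈ P.block (P.cls x) := (P.mem_block_iff _ _).2 rfl

/-- Distinct blocks are disjoint. [cite: ArakiMoriya2003, §11.1 (mutually disjoint regions)] -/
theorem disjoint_block {i j : ι} (h : i ≠ j) : Disjoint (P.block i) (P.block j) :=
  Finset.disjoint_left.2 fun x hi hj => h (((P.mem_block_iff i x).1 hi).symm.trans ((P.mem_block_iff j x).1 hj))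

variable [DecidableEq ι]

/-- **The part of a region in block `i`**: `Λ ∩ B_i` (as the sites of `Λ` of class `i`).
[cite: ArakiMoriya2003, §11.1 (the regions `I_i ∩ Λ`)] -/
def blockLoc (Λ : Finset (Site d)) (i : ι) : Finset (Site d) := Λ.filter fun x => P.cls x = i

/-- Membership in a part. [cite: ArakiMoriya2003, §11.1] -/
@[simp] theorem mem_blockLoc {Λ : Finset (Site d)} {i : ι} {x : Site d} : x ∈ P.blockLoc Λ i ↔ x ∈ Λ ∧ P.cls x = i :=
  Finset.mem_filter

/-- A part lies in the region. [cite: ArakiMoriya2003, §11.1] -/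
theorem blockLoc_subset (Λ : Finset (Site d)) (i : ι) : P.blockLoc Λ i ⊆ Λ := Finset.filter_subset _ _

/-- A part lies in its block. [cite: ArakiMoriya2003, §11.1] -/
theorem blockLoc_subset_block (Λ : Finset (Site d)) (i : ι) : P.blockLoc Λ i ⊆ P.block i :=
  fun _ hx => (P.mem_block_iff _ _).2 (P.mem_blockLoc.1 hx).2

/-- The parts are monotone in the region. [cite: ArakiMoriya2003, §11.1] -/
theorem blockLoc_mono {Λ Λ' : Finset (Site d)} (h : Λ ⊆ Λ') (i : ι) : P.blockLoc Λ i ⊆ P.blockLoc Λ' i :=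
  fun _ hx => P.mem_blockLoc.2 ⟨h (P.mem_blockLoc.1 hx).1, (P.mem_blockLoc.1 hx).2⟩

/-- A block inside the region is its own part. [cite: ArakiMoriya2003, §11.1] -/
theorem blockLoc_eq_block_of_subset {Λ : Finset (Site d)} {i : ι} (h : P.block i ⊆ Λ) : P.blockLoc Λ i = P.block i := by
  ext x
  rw [mem_blockLoc, P.mem_block_iff]
  exact ⟨fun hx => hx.2, fun hx => ⟨h ((P.mem_block_iff _ _).2 hx), hx⟩⟩

/-- The part of a block in itself is the block. [cite: ArakiMoriya2003, §11.1] -/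
theorem blockLoc_block (i : ι) : P.blockLoc (P.block i) i = P.block i := P.blockLoc_eq_block_of_subset subset_rfl

/-- Distinct parts are disjoint. [cite: ArakiMoriya2003, §11.1] -/
theorem disjoint_blockLoc (Λ : Finset (Site d)) {i j : ι} (h : i ≠ j) : Disjoint (P.blockLoc Λ i) (P.blockLoc Λ j) :=
  Finset.disjoint_left.2 fun _ hi hj => h ((P.mem_blockLoc.1 hi).2.symm.trans (P.mem_blockLoc.1 hj).2)

/-- **The classes met by a region.** [cite: ArakiMoriya2003, §11.1] -/
def blockClasses (Λ : Finset (Site d)) : Finset ι := Λ.image P.cls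

/-- The class of a site of the region is met. [cite: ArakiMoriya2003, §11.1] -/
theorem cls_mem_blockClasses {Λ : Finset (Site d)} {x : Site d} (hx : x ∈ Λ) : P.cls x ∈ P.blockClasses Λ :=
  Finset.mem_image_of_mem _ hx

/-- Membership in the classes met. [cite: ArakiMoriya2003, §11.1] -/
theorem mem_blockClasses_iff {Λ : Finset (Site d)} {i : ι} : i ∈ P.blockClasses Λ ↔ (P.blockLoc Λ i).Nonempty := by
  rw [blockClasses, Finset.mem_image]
  exact ⟨fun ⟨x, hx, hi⟩ => ⟨x, P.mem_blockLoc.2 ⟨hx, hi⟩⟩, fun ⟨x, hx⟩ => ⟨x, (P.mem_blockLoc.1 hx).1, (P.mem_blockLoc.1 hx).2⟩⟩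

/-- The classes met are monotone in the region. [cite: ArakiMoriya2003, §11.1] -/
theorem blockClasses_mono {Λ Λ' : Finset (Site d)} (h : Λ ⊆ Λ') : P.blockClasses Λ ⊆ P.blockClasses Λ' :=
  Finset.image_subset_image h

/-- A class absent from a region has an empty part there. [cite: ArakiMoriya2003, §11.1] -/
theorem blockLoc_eq_empty_of_notMem {Λ : Finset (Site d)} {i : ι} (hi : i ∉ P.blockClasses Λ) : P.blockLoc Λ i = ∅ :=
  Finset.not_nonempty_iff_eq_empty.1 fun h => hi (P.mem_blockClasses_iff.2 h)

/-- A block inside the region is a class met (blocks are non-empty as soon as they lie in a region and carry a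
site; stated with the witness). [cite: ArakiMoriya2003, §11.1] -/
theorem mem_blockClasses_of_mem {Λ : Finset (Site d)} {i : ι} {x : Site d} (hx : x ∈ Λ) (hi : P.cls x = i) :
    i ∈ P.blockClasses Λ := hi ▸ P.cls_mem_blockClasses hx

/-- **The parts tile the region**: `Σ_{i ∈ classes Λ} |Λ ∩ B_i| = |Λ|`. [cite: ArakiMoriya2003, §11.1] -/
theorem sum_card_blockLoc (Λ : Finset (Site d)) : ∑ i ∈ P.blockClasses Λ, (P.blockLoc Λ i).card = Λ.card :=
  (Finset.card_eq_sum_card_image P.cls Λ).symm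

/-- **The part embeddings** `𝔄(Λ ∩ B_i) → 𝔄(Λ)` are the isotony maps; as site injections. [cite: ArakiMoriya2003, §4.1 Def. 4.1 (2)] -/
abbrev blockEmb (Λ : Finset (Site d)) (i : ι) : PolySite (P.blockLoc Λ i) ↪ PolySite Λ := PolySite.incl (P.blockLoc_subset Λ i)

/-- The image sites of the `i`-th part embedding are the sites of class `i`. [cite: ArakiMoriya2003, §4.1] -/
theorem mem_map_blockEmb_iff {Λ : Finset (Site d)} {i : ι} {y : PolySite Λ} :
    y ∈ (Finset.univ : Finset (PolySite (P.blockLoc Λ i))).map (P.blockEmb Λ i) ↔ P.cls (ofLex y.1) = i := by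
  rw [Finset.mem_map]
  constructor
  · rintro ⟨z, -, rfl⟩
    exact (P.mem_blockLoc.1 (PolySite.ofLex_mem z)).2
  · intro h
    exact ⟨PolySite.pt (ofLex y.1) (P.mem_blockLoc.2 ⟨PolySite.ofLex_mem y, h⟩), Finset.mem_univ _, Subtype.ext rfl⟩

/-- **The part embeddings have pairwise disjoint images** (the hypothesis of `boxProd`). [cite: ArakiMoriya2003, §11.1] -/
theorem disjoint_map_blockEmb (Λ : Finset (Site d)) :
    ∀ i j : ι, i ≠ j → Disjoint ((Finset.univ : Finset (PolySite (P.blockLoc Λ i))).map (P.blockEmb Λ i))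
      ((Finset.univ : Finset (PolySite (P.blockLoc Λ j))).map (P.blockEmb Λ j)) := fun _ _ hij =>
  Finset.disjoint_left.2 fun _ hi hj => hij ((P.mem_map_blockEmb_iff.1 hi).symm.trans (P.mem_map_blockEmb_iff.1 hj))

/-- Isotony composes with the part embeddings: `Γ(Λ ⊆ Λ') ∘ Γ_i^{Λ} = Γ_i^{Λ'} ∘ Γ(Λ∩B_i ⊆ Λ'∩B_i)`.
[cite: ArakiMoriya2003, §4.1 Def. 4.1 (2)] -/
theorem fermionEmbed_incl_fermionEmbed_blockEmb {Λ Λ' : Finset (Site d)} (h : Λ ⊆ Λ') (i : ι) (a : FermionOp (P.blockLoc Λ i)) :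
    fermionEmbed (PolySite.incl h) (fermionEmbed (P.blockEmb Λ i) a) =
      fermionEmbed (P.blockEmb Λ' i) (fermionEmbed (PolySite.incl (P.blockLoc_mono h i)) a) := by
  rw [fermionEmbed_fermionEmbed, fermionEmbed_fermionEmbed, PolySite.incl_trans, PolySite.incl_trans]

end BlockPartition

/-! ### §2. Block marginals and block values -/

section Marginals

variable {d : ℕ} {ι : Type*} (P : BlockPartition d ι) (ρ : (i : ι) → FermionOp (P.block i))

/-- **The value of the block state on an observable of a sub-region of its block**: `tr(Γ_{X ⊆ B_i} b · ρ_i)`.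
[cite: ArakiMoriya2003, §4.1 Def. 4.5] -/
def blockVal (i : ι) {X : Finset (Site d)} (hX : X ⊆ P.block i) (b : FermionOp X) : ℂ :=
  (fermionEmbed (PolySite.incl hX) b * ρ i).trace

/-- Unfolding the block value. [cite: ArakiMoriya2003, §4.1 Def. 4.5] -/
theorem blockVal_apply (i : ι) {X : Finset (Site d)} (hX : X ⊆ P.block i) (b : FermionOp X) :
    blockVal P ρ i hX b = (fermionEmbed (PolySite.incl hX) b * ρ i).trace := rfl

/-- The block value only depends on the observable embedded into the block: compatibility along `X ⊆ X' ⊆ B_i`.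
[cite: ArakiMoriya2003, §4.1 Def. 4.5] -/
theorem blockVal_fermionEmbed_incl (i : ι) {X X' : Finset (Site d)} (hXX' : X ⊆ X') (hX' : X' ⊆ P.block i) (b : FermionOp X) :
    blockVal P ρ i hX' (fermionEmbed (PolySite.incl hXX') b) = blockVal P ρ i (hXX'.trans hX') b := by
  rw [blockVal, blockVal, fermionEmbed_fermionEmbed, PolySite.incl_trans]

/-- The block value on the whole block is `tr(b ρ_i)`. [cite: ArakiMoriya2003, §4.1 Def. 4.5] -/
theorem blockVal_self (i : ι) (b : FermionOp (P.block i)) : blockVal P ρ i subset_rfl b = (b * ρ i).trace := by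
  rw [blockVal, PolySite.incl_rfl, fermionEmbed_refl_apply]

/-- The block value of `𝟙` is the trace of the block state. [cite: ArakiMoriya2003, §4.1 Def. 4.5] -/
theorem blockVal_one (i : ι) {X : Finset (Site d)} (hX : X ⊆ P.block i) : blockVal P ρ i hX 1 = (ρ i).trace := by
  rw [blockVal, fermionEmbed_one, Matrix.one_mul]

variable [DecidableEq ι]

/-- **The block marginal on a region**: the reduced density matrix `tr_{Λ∩B_i ⊆ B_i} ρ_i ∈ 𝔄(Λ ∩ B_i)` of the block
state on the part of `Λ` in block `i`. [cite: ArakiMoriya2003, §4.1 Def. 4.5 (restriction of a state to `𝔄(I)`)] -/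
def blockMarginal (Λ : Finset (Site d)) (i : ι) : FermionOp (P.blockLoc Λ i) :=
  fermionPartialTrace (PolySite.incl (P.blockLoc_subset_block Λ i)) (ρ i)

/-- **The marginal reproduces the block values**: `tr(b · tr_{Λ∩B_i} ρ_i) = tr(Γ b · ρ_i)`.
[cite: ArakiMoriya2003, §4.1 Def. 4.5] -/
theorem trace_mul_blockMarginal (Λ : Finset (Site d)) (i : ι) (b : FermionOp (P.blockLoc Λ i)) :
    (b * blockMarginal P ρ Λ i).trace = blockVal P ρ i (P.blockLoc_subset_block Λ i) b :=
  trace_mul_fermionPartialTrace _ _ _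

/-- Same with the factors swapped. [cite: ArakiMoriya2003, §4.1 Def. 4.5] -/
theorem trace_blockMarginal_mul (Λ : Finset (Site d)) (i : ι) (b : FermionOp (P.blockLoc Λ i)) :
    (blockMarginal P ρ Λ i * b).trace = blockVal P ρ i (P.blockLoc_subset_block Λ i) b := by
  rw [Matrix.trace_mul_comm, trace_mul_blockMarginal]

/-- The marginal has the trace of the block state. [cite: ArakiMoriya2003, §4.1 Def. 4.5] -/
theorem trace_blockMarginal (Λ : Finset (Site d)) (i : ι) : (blockMarginal P ρ Λ i).trace = (ρ i).trace :=
  trace_fermionPartialTrace _ _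

variable {ρ}

/-- The marginal of an even block state is even. [cite: ArakiMoriya2003, §11.1 Lemma 11.1] -/
theorem parityAut_blockMarginal (hev : ∀ i, parityAut (ρ i) = ρ i) (Λ : Finset (Site d)) (i : ι) :
    parityAut (blockMarginal P ρ Λ i) = blockMarginal P ρ Λ i :=
  parityAut_fermionPartialTrace_of_even _ (hev i)

/-- The marginal of a positive block state is positive semidefinite. [cite: ArakiMoriya2003, §11.1 Theorem 11.2] -/
theorem posSemidef_blockMarginal (hpsd : ∀ i, (ρ i).PosSemidef) (Λ : Finset (Site d)) (i : ι) :
    (blockMarginal P ρ Λ i).PosSemidef :=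
  posSemidef_fermionPartialTrace _ (hpsd i)

/-- On an EMPTY part the marginal of a normalised block state is `𝟙` (the `1 × 1` matrix `tr ρ_i = 1`).
[cite: ArakiMoriya2003, §11.1] -/
theorem blockMarginal_eq_one_of_eq_empty (htr : ∀ i, (ρ i).trace = 1) {Λ : Finset (Site d)} {i : ι} (h : P.blockLoc Λ i = ∅) :
    blockMarginal P ρ Λ i = 1 := by
  haveI : IsEmpty (PolySite (P.blockLoc Λ i)) :=
    ⟨fun y => Finset.eq_empty_iff_forall_notMem.1 h _ (PolySite.ofLex_mem y)⟩
  haveI : IsEmpty (Orb (PolySite (P.blockLoc Λ i))) := ⟨fun o => isEmptyElim (ofLex o).1⟩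
  have huniq : ∀ s : Finset (Orb (PolySite (P.blockLoc Λ i))), s = ∅ := fun s => Finset.eq_empty_of_forall_notMem fun o _ => isEmptyElim o
  ext s t
  rw [huniq s, huniq t, Matrix.one_apply_eq]
  have h1 := trace_blockMarginal P ρ Λ i
  rw [htr i, Matrix.trace, Fintype.sum_eq_single ∅ (fun s hs => absurd (huniq s) hs)] at h1
  exact h1

end Marginals

/-! ### §3. The local density matrix `Π_{i ∈ classes Λ} Γ_i (tr_{Λ∩B_i} ρ_i)` and the product formula -/

section Density

variable {d : ℕ} {ι : Type*} [DecidableEq ι] (P : BlockPartition d ι) (ρ : (i : ι) → FermionOp (P.block i))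
  (hev : ∀ i, parityAut (ρ i) = ρ i)

/-- **The local density matrix of the block product on `Λ`**: the box product, over the classes met by `Λ`, of the
embedded block marginals (Araki–Moriya's `ρ = ρ_n ⋯ ρ_1`; the factors are even, hence commute).
[cite: ArakiMoriya2003, §11.1 Theorem 11.2 eq. (11.5)] -/
def blockDensity (Λ : Finset (Site d)) : FermionOp Λ :=
  boxProd (P.disjoint_map_blockEmb Λ) (blockMarginal P ρ Λ) (parityAut_blockMarginal P hev Λ) (P.blockClasses Λ)

/-- Unfolding. [cite: ArakiMoriya2003, §11.1 Theorem 11.2 eq. (11.5)] -/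
theorem blockDensity_def (Λ : Finset (Site d)) :
    blockDensity P ρ hev Λ =
      boxProd (P.disjoint_map_blockEmb Λ) (blockMarginal P ρ Λ) (parityAut_blockMarginal P hev Λ) (P.blockClasses Λ) := rfl

/-- The local density is `Θ`-even. [cite: ArakiMoriya2003, §11.1 Lemma 11.1] -/
theorem parityAut_blockDensity (Λ : Finset (Site d)) : parityAut (blockDensity P ρ hev Λ) = blockDensity P ρ hev Λ :=
  parityAut_boxProd _ _ _

variable {ρ hev}

/-- The local density of positive block states is positive semidefinite. [cite: ArakiMoriya2003, §11.1 Theorem 11.2] -/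
theorem posSemidef_blockDensity (hpsd : ∀ i, (ρ i).PosSemidef) (Λ : Finset (Site d)) : (blockDensity P ρ hev Λ).PosSemidef :=
  posSemidef_boxProd _ _ (posSemidef_blockMarginal P hpsd Λ) _

/-- `τ(blockDensity) = Π_{i ∈ classes Λ} τ(marginal_i)`. [cite: ArakiMoriya2003, §4.1 eq. (4.16)] -/
theorem normTrace_blockDensity (Λ : Finset (Site d)) :
    normTrace (blockDensity P ρ hev Λ) = ∏ i ∈ P.blockClasses Λ, normTrace (blockMarginal P ρ Λ i) :=
  normTrace_boxProd _ _ _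

/-- `|Orb X| = 2|X|` for a region of `ℤ^d` (re-derived). [folklore] -/
private theorem card_orb_polySite' (Λ : Finset (Site d)) : Fintype.card (Orb (PolySite Λ)) = 2 * Λ.card := by
  rw [Fintype.card_congr (show Orb (PolySite Λ) ≃ PolySite Λ × Fin 2 from (toLex : PolySite Λ × Fin 2 ≃ Orb (PolySite Λ)).symm),
    Fintype.card_prod, Fintype.card_fin, Fintype.card_coe, mul_comm]
  rw [lexSites, Finset.card_map]

/-- **The normalising powers of two tile**: `2^{|Orb Λ|} = Π_{i ∈ classes Λ} 2^{|Orb (Λ ∩ B_i)|}`. [cite: ArakiMoriya2003, §11.1] -/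
theorem two_pow_card_orb_eq_prod_blockLoc (Λ : Finset (Site d)) :
    (2 : ℂ) ^ Fintype.card (Orb (PolySite Λ)) = ∏ i ∈ P.blockClasses Λ, (2 : ℂ) ^ Fintype.card (Orb (PolySite (P.blockLoc Λ i))) := by
  rw [Finset.prod_pow_eq_pow_sum, card_orb_polySite']
  simp_rw [card_orb_polySite']
  rw [← Finset.mul_sum, P.sum_card_blockLoc]

/-- **`tr(blockDensity) = 1`** for normalised block states (the parts tile `Λ`).
[cite: ArakiMoriya2003, §11.1 Theorem 11.2 ("This also shows `φ(𝟙) = 1`")] -/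
theorem trace_blockDensity (htr : ∀ i, (ρ i).trace = 1) (Λ : Finset (Site d)) : (blockDensity P ρ hev Λ).trace = 1 := by
  have h := normTrace_blockDensity P Λ (ρ := ρ) (hev := hev)
  simp only [normTrace_apply, trace_blockMarginal, htr, one_div] at h
  rw [div_eq_iff (pow_ne_zero _ two_ne_zero), Finset.prod_inv_distrib, ← two_pow_card_orb_eq_prod_blockLoc] at h
  rw [h, inv_mul_cancel₀ (pow_ne_zero _ two_ne_zero)]

/-- **The local density does not see absent classes**: enlarging the index set by classes whose parts are empty
does not change the box product (those marginals are `𝟙`). [cite: ArakiMoriya2003, §11.1 Theorem 11.2] -/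
theorem boxProd_blockMarginal_eq_of_subset (htr : ∀ i, (ρ i).trace = 1) (Λ : Finset (Site d)) {S T : Finset ι} (hTS : T ⊆ S)
    (hS : ∀ i ∈ S, i ∉ T → P.blockLoc Λ i = ∅) :
    boxProd (P.disjoint_map_blockEmb Λ) (blockMarginal P ρ Λ) (parityAut_blockMarginal P hev Λ) S =
      boxProd (P.disjoint_map_blockEmb Λ) (blockMarginal P ρ Λ) (parityAut_blockMarginal P hev Λ) T := by
  induction S using Finset.induction_on generalizing T with
  | empty => rw [Finset.subset_empty.1 hTS]
  | insert k S hk ih =>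
    by_cases hkT : k ∈ T
    · rw [boxProd_insert _ _ hk, boxProd_eq_mul_erase _ _ hkT]
      congr 1
      refine ih (fun j hj => ?_) (fun j hjS hjT => ?_)
      · exact (Finset.mem_insert.1 (hTS (Finset.mem_of_mem_erase hj))).resolve_left (Finset.ne_of_mem_erase hj)
      · exact hS j (Finset.mem_insert_of_mem hjS) fun hjT' => hjT (Finset.mem_erase.2 ⟨fun h => hk (h ▸ hjS), hjT'⟩)
    · rw [boxProd_insert _ _ hk, blockMarginal_eq_one_of_eq_empty P htr (hS k (Finset.mem_insert_self k S) hkT), map_one,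
        Matrix.one_mul, ih (fun j hj => (Finset.mem_insert.1 (hTS hj)).resolve_left (fun h => hkT (h ▸ hj)))
          (fun j hjS hjT => hS j (Finset.mem_insert_of_mem hjS) hjT)]

/-- **THE PRODUCT FORMULA** (Araki–Moriya (11.4)) for the local density: against an ordered product of observables
of DISTINCT parts (a list of pairs (class, observable of `Λ ∩ B_i`), classes pairwise distinct and met by `Λ`),
`tr(blockDensity · Π_j Γ_{i_j} b_j) = Π_j blockVal ρ i_j b_j`. [cite: ArakiMoriya2003, §11.1 Theorem 11.2 eq. (11.4)] -/
theorem trace_blockDensity_mul_prod (htr : ∀ i, (ρ i).trace = 1) (Λ : Finset (Site d))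
    (L : List (Σ i : ι, FermionOp (P.blockLoc Λ i))) (hL : (L.map Sigma.fst).Nodup) (hLS : ∀ p ∈ L, p.1 ∈ P.blockClasses Λ) :
    (blockDensity P ρ hev Λ * (L.map fun p => fermionEmbed (P.blockEmb Λ p.1) p.2).prod).trace =
      (L.map fun p => blockVal P ρ p.1 (P.blockLoc_subset_block Λ p.1) p.2).prod := by
  have h := normTrace_boxProd_mul_prod (P.disjoint_map_blockEmb Λ) (parityAut_blockMarginal P hev Λ) (P.blockClasses Λ) L hL hLS
  rw [← blockDensity_def P ρ hev] at h
  -- the unpaired marginals have `τ = 2^{-N_i}`, the paired ones `τ(m b) = tr(m b)/2^{N_i}`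
  have hτ : ∀ i, normTrace (blockMarginal P ρ Λ i) = ((2 : ℂ) ^ Fintype.card (Orb (PolySite (P.blockLoc Λ i))))⁻¹ := fun i => by
    rw [normTrace_apply, trace_blockMarginal, htr, one_div]
  have hτb : ∀ p : (Σ i : ι, FermionOp (P.blockLoc Λ i)), normTrace (blockMarginal P ρ Λ p.1 * p.2) =
      ((2 : ℂ) ^ Fintype.card (Orb (PolySite (P.blockLoc Λ p.1))))⁻¹ * blockVal P ρ p.1 (P.blockLoc_subset_block Λ p.1) p.2 := fun p => by
    rw [normTrace_apply, trace_blockMarginal_mul, div_eq_inv_mul]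
  simp only [hτ, hτb] at h
  rw [normTrace_apply, div_eq_iff (pow_ne_zero _ two_ne_zero)] at h
  rw [h, List.prod_map_mul, Finset.prod_inv_distrib]
  -- `Π_{i ∈ L} 2^{-N_i} · Π_{i ∈ S ∖ L} 2^{-N_i} · 2^{N} = 1`
  have hsplit : (∏ i ∈ P.blockClasses Λ, (2 : ℂ) ^ Fintype.card (Orb (PolySite (P.blockLoc Λ i)))) =
      (L.map fun p => (2 : ℂ) ^ Fintype.card (Orb (PolySite (P.blockLoc Λ p.1)))).prod *
        ∏ i ∈ P.blockClasses Λ \ (L.map Sigma.fst).toFinset, (2 : ℂ) ^ Fintype.card (Orb (PolySite (P.blockLoc Λ i))) := by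
    have hsub : (L.map Sigma.fst).toFinset ⊆ P.blockClasses Λ := fun i hi => by
      obtain ⟨p, hp, rfl⟩ := List.mem_map.1 (List.mem_toFinset.1 hi)
      exact hLS p hp
    rw [← Finset.prod_sdiff hsub, mul_comm]
    congr 1
    rw [List.prod_toFinset _ hL, List.map_map]
    rfl
  have hne : (L.map fun p => (2 : ℂ) ^ Fintype.card (Orb (PolySite (P.blockLoc Λ p.1)))).prod ≠ 0 :=
    List.prod_ne_zero fun h0 => by
      obtain ⟨p, -, hp⟩ := List.mem_map.1 h0
      exact pow_ne_zero _ two_ne_zero hp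
  have hne' : ∏ i ∈ P.blockClasses Λ \ (L.map Sigma.fst).toFinset, (2 : ℂ) ^ Fintype.card (Orb (PolySite (P.blockLoc Λ i))) ≠ 0 :=
    Finset.prod_ne_zero_iff.2 fun i _ => pow_ne_zero _ two_ne_zero
  rw [two_pow_card_orb_eq_prod_blockLoc P Λ, hsplit]
  have hinv : (L.map fun p => ((2 : ℂ) ^ Fintype.card (Orb (PolySite (P.blockLoc Λ p.1))))⁻¹).prod =
      ((L.map fun p => (2 : ℂ) ^ Fintype.card (Orb (PolySite (P.blockLoc Λ p.1)))).prod)⁻¹ := by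
    rw [List.prod_inv]
    simp only [List.map_map, Function.comp_def]
  rw [hinv]
  field_simp

/-- Product formula for ONE part observable: `tr(blockDensity · Γ_i b) = blockVal ρ i b` (`i` met by `Λ`).
[cite: ArakiMoriya2003, §11.1 Theorem 11.2 eq. (11.4)] -/
theorem trace_blockDensity_mul_fermionEmbed (htr : ∀ i, (ρ i).trace = 1) (Λ : Finset (Site d)) {i : ι} (hi : i ∈ P.blockClasses Λ)
    (b : FermionOp (P.blockLoc Λ i)) :
    (blockDensity P ρ hev Λ * fermionEmbed (P.blockEmb Λ i) b).trace = blockVal P ρ i (P.blockLoc_subset_block Λ i) b := by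
  have h := trace_blockDensity_mul_prod P htr Λ [⟨i, b⟩] (by simp) (by simpa using hi) (hev := hev)
  simpa using h

end Density

/-! ### §4. Words factor through the parts; the local functionals are compatible with isotony -/

section Words

variable {d : ℕ} {ι : Type*} [DecidableEq ι] (P : BlockPartition d ι)

/-- **Every word factors through the parts, up to a sign**: for a duplicate-free list `L` of classes containing all
classes met by `Λ`, the operator of any word in the generators of `𝔄(Λ)` is `± Π_{i ∈ L} Γ_i(a_i)` with
`a_i ∈ 𝔄(Λ ∩ B_i)` (the class-`i` letters). [cite: ArakiMoriya2003, §11.1 Theorem 11.2 ("the monomials … are total in `𝔄(I)`")] -/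
theorem BlockPartition.exists_wordOp_eq_sign_smul_prod_fermionEmbed (Λ : Finset (Site d)) (L : List ι) (hL : L.Nodup)
    (hΛL : ∀ x ∈ Λ, P.cls x ∈ L) (w : List (JWLetter (Orb (PolySite Λ)))) :
    ∃ (n : ℕ) (a : (i : ι) → FermionOp (P.blockLoc Λ i)),
      wordOp w = (-1 : ℂ) ^ n • (L.map fun i => fermionEmbed (P.blockEmb Λ i) (a i)).prod := by
  obtain ⟨n, hn⟩ := wordOp_eq_sign_smul_prod_filter (fun o : Orb (PolySite Λ) => P.cls (ofLex (ofLex o).1.1))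
    L hL w (fun l _ => hΛL _ (PolySite.ofLex_mem _))
  have hlift : ∀ i : ι, ∀ v : List (JWLetter (Orb (PolySite Λ))),
      (∀ l ∈ v, P.cls (ofLex (ofLex l.1).1.1) = i) →
        ∃ u : List (JWLetter (Orb (PolySite (P.blockLoc Λ i)))), fermionEmbed (P.blockEmb Λ i) (wordOp u) = wordOp v := by
    intro i v hv
    induction v with
    | nil => exact ⟨[], by rw [wordOp_nil, fermionEmbed_one, wordOp_nil]⟩
    | cons l v ih =>
      obtain ⟨u, hu⟩ := ih fun m hm => hv m (List.mem_cons_of_mem _ hm)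
      have hi := hv l List.mem_cons_self
      have hy : ofLex (ofLex l.1).1.1 ∈ P.blockLoc Λ i := P.mem_blockLoc.2 ⟨PolySite.ofLex_mem _, hi⟩
      refine ⟨(orb (PolySite.pt _ hy) (ofLex l.1).2, l.2) :: u, ?_⟩
      rw [wordOp_cons, fermionEmbed_mul, hu, wordOp_cons, fermionEmbed_letterOp]
      rfl
  choose u hu using fun i => hlift i (w.filter fun l => P.cls (ofLex (ofLex l.1).1.1) = i)
    (fun l hl => by simpa using (List.mem_filter.1 hl).2)
  refine ⟨n, fun i => wordOp (u i), ?_⟩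
  rw [hn]
  congr 1
  exact congrArg List.prod (List.map_congr_left fun i _ => (hu i).symm)

variable (ρ : (i : ι) → FermionOp (P.block i)) (hev : ∀ i, parityAut (ρ i) = ρ i) (htr : ∀ i, (ρ i).trace = 1)

/-- **The local product functional** `A ↦ tr(blockDensity Λ · A)` on `𝔄(Λ)`. [cite: ArakiMoriya2003, §11.1 Theorem 11.2 eq. (11.6)] -/
def blockExpect (Λ : Finset (Site d)) : FermionOp Λ →ₗ[ℂ] ℂ where
  toFun A := (blockDensity P ρ hev Λ * A).trace
  map_add' A B := by rw [Matrix.mul_add, Matrix.trace_add]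
  map_smul' c A := by rw [Matrix.mul_smul, Matrix.trace_smul, RingHom.id_apply]

/-- Unfolding. [cite: ArakiMoriya2003, §11.1 Theorem 11.2 eq. (11.6)] -/
theorem blockExpect_apply (Λ : Finset (Site d)) (A : FermionOp Λ) : blockExpect P ρ hev Λ A = (blockDensity P ρ hev Λ * A).trace := rfl

variable {ρ hev}
include htr

/-- **Product formula for the local functional** on `Π_{i ∈ l} Γ_i (a i)` for a duplicate-free list `l` of classes
containing the classes met by `Λ` (absent classes carry `1 × 1` observables and block values `a_i(∅,∅)`).
[cite: ArakiMoriya2003, §11.1 Theorem 11.2 eq. (11.4)] -/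
theorem blockExpect_prod (Λ : Finset (Site d)) (l : List ι) (hl : l.Nodup) (hΛl' : ∀ i ∈ P.blockClasses Λ, i ∈ l)
    (a : (i : ι) → FermionOp (P.blockLoc Λ i)) :
    blockExpect P ρ hev Λ (l.map fun i => fermionEmbed (P.blockEmb Λ i) (a i)).prod =
      (l.map fun i => blockVal P ρ i (P.blockLoc_subset_block Λ i) (a i)).prod := by
  have hΛl : P.blockClasses Λ ⊆ l.toFinset := fun i hi => List.mem_toFinset.2 (hΛl' i hi)
  -- enlarge the index set of the density to `l.toFinset` (absent classes contribute `𝟙`)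
  have hdens : blockDensity P ρ hev Λ =
      boxProd (P.disjoint_map_blockEmb Λ) (blockMarginal P ρ Λ) (parityAut_blockMarginal P hev Λ) l.toFinset := by
    rw [blockDensity_def]
    exact (boxProd_blockMarginal_eq_of_subset P (hev := hev) htr Λ hΛl fun i _ hi => P.blockLoc_eq_empty_of_notMem hi).symm
  -- the product formula over `l.toFinset` with all classes paired
  have h := normTrace_boxProd_mul_prod (P.disjoint_map_blockEmb Λ) (parityAut_blockMarginal P hev Λ) l.toFinset
    (l.map fun i => (⟨i, a i⟩ : Σ j : ι, FermionOp (P.blockLoc Λ j))) (by simpa [List.map_map, Function.comp_def] using hl)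
    (fun p hp => by
      obtain ⟨i, hi, rfl⟩ := List.mem_map.1 hp
      exact List.mem_toFinset.2 hi)
  have hsd : l.toFinset \ ((l.map fun i => (⟨i, a i⟩ : Σ j : ι, FermionOp (P.blockLoc Λ j))).map Sigma.fst).toFinset = ∅ := by
    rw [List.map_map, Finset.sdiff_eq_empty_iff_subset]
    intro i hi
    exact List.mem_toFinset.2 (by simpa [Function.comp_def] using List.mem_toFinset.1 hi)
  rw [hsd, Finset.prod_empty, mul_one, List.map_map, List.map_map, ← hdens] at h
  -- convert `τ` to `tr`
  have hτb : ∀ i, normTrace (blockMarginal P ρ Λ i * a i) =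
      ((2 : ℂ) ^ Fintype.card (Orb (PolySite (P.blockLoc Λ i))))⁻¹ * blockVal P ρ i (P.blockLoc_subset_block Λ i) (a i) := fun i => by
    rw [normTrace_apply, trace_blockMarginal_mul, div_eq_inv_mul]
  rw [blockExpect_apply]
  rw [normTrace_apply, div_eq_iff (pow_ne_zero _ two_ne_zero)] at h
  simp only [Function.comp_def, hτb] at h
  rw [show (fun i => fermionEmbed (P.blockEmb Λ i) (a i)) = fun i => fermionEmbed (P.blockEmb Λ (⟨i, a i⟩ : Σ j : ι, FermionOp (P.blockLoc Λ j)).1)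
      (⟨i, a i⟩ : Σ j : ι, FermionOp (P.blockLoc Λ j)).2 from rfl, h, List.prod_map_mul]
  -- `Π_{i∈l} 2^{-N_i} · 2^N = 1` since the parts of the classes of `l` tile `Λ` (absent ones have `N_i = 0`)
  have hpow : (2 : ℂ) ^ Fintype.card (Orb (PolySite Λ)) = (l.map fun i => (2 : ℂ) ^ Fintype.card (Orb (PolySite (P.blockLoc Λ i)))).prod := by
    rw [two_pow_card_orb_eq_prod_blockLoc P Λ, ← List.prod_toFinset _ hl]
    refine (Finset.prod_subset hΛl fun i _ hi => ?_)
    haveI : IsEmpty (PolySite (P.blockLoc Λ i)) :=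
      ⟨fun y => Finset.eq_empty_iff_forall_notMem.1 (P.blockLoc_eq_empty_of_notMem hi) _ (PolySite.ofLex_mem y)⟩
    haveI : IsEmpty (Orb (PolySite (P.blockLoc Λ i))) := ⟨fun o => isEmptyElim (ofLex o).1⟩
    rw [Fintype.card_eq_zero, pow_zero]
  have hinv : (l.map fun i => ((2 : ℂ) ^ Fintype.card (Orb (PolySite (P.blockLoc Λ i))))⁻¹).prod =
      ((l.map fun i => (2 : ℂ) ^ Fintype.card (Orb (PolySite (P.blockLoc Λ i)))).prod)⁻¹ := by
    rw [List.prod_inv, List.map_map, Function.comp_def]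
  have hne : (l.map fun i => (2 : ℂ) ^ Fintype.card (Orb (PolySite (P.blockLoc Λ i)))).prod ≠ 0 :=
    List.prod_ne_zero fun h0 => by
      obtain ⟨p, -, hp⟩ := List.mem_map.1 h0
      exact pow_ne_zero _ two_ne_zero hp
  rw [hinv, hpow, mul_comm, ← mul_assoc, mul_inv_cancel₀ hne, one_mul]

/-- **Compatibility with isotony**: the restriction of the local functional of `Λ' ⊇ Λ` to `𝔄(Λ)` is the local
functional of `Λ` (checked on words, which factor through the parts up to a common sign; block values are compatible).
[cite: ArakiMoriya2003, §11.1 Theorem 11.2 (Case 2)] -/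
theorem blockExpect_fermionEmbed_incl {Λ Λ' : Finset (Site d)} (h : Λ ⊆ Λ') (A : FermionOp Λ) :
    blockExpect P ρ hev Λ' (fermionEmbed (PolySite.incl h) A) = blockExpect P ρ hev Λ A := by
  have hA : A ∈ Submodule.span ℂ {M | ∃ w : List (JWLetter (Orb (PolySite Λ))), LettersIn Finset.univ w ∧ wordOp w = M} :=
    mem_span_wordOp_of_mem_carSubalgebra (by rw [carSubalgebra_univ_eq_top]; exact Algebra.mem_top)
  refine Submodule.span_induction (p := fun A _ =>
    blockExpect P ρ hev Λ' (fermionEmbed (PolySite.incl h) A) = blockExpect P ρ hev Λ A) ?_ ?_ ?_ ?_ hA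
  · rintro _ ⟨w, -, rfl⟩
    have hΛl : ∀ i ∈ P.blockClasses Λ, i ∈ (P.blockClasses Λ').toList := fun i hi =>
      Finset.mem_toList.2 (P.blockClasses_mono h hi)
    have hΛ'l : ∀ i ∈ P.blockClasses Λ', i ∈ (P.blockClasses Λ').toList := fun i hi => Finset.mem_toList.2 hi
    obtain ⟨n, a, hw⟩ := P.exists_wordOp_eq_sign_smul_prod_fermionEmbed Λ (P.blockClasses Λ').toList (Finset.nodup_toList _)
      (fun x hx => Finset.mem_toList.2 (P.blockClasses_mono h (P.cls_mem_blockClasses hx))) w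
    have hmap : ((P.blockClasses Λ').toList.map fun i => fermionEmbed (P.blockEmb Λ i) (a i)).map (fermionEmbed (PolySite.incl h)) =
        (P.blockClasses Λ').toList.map fun i => fermionEmbed (P.blockEmb Λ' i) (fermionEmbed (PolySite.incl (P.blockLoc_mono h i)) (a i)) := by
      rw [List.map_map]
      exact List.map_congr_left fun i _ => P.fermionEmbed_incl_fermionEmbed_blockEmb h i (a i)
    have hval : ((P.blockClasses Λ').toList.map fun i =>
        blockVal P ρ i (P.blockLoc_subset_block Λ' i) (fermionEmbed (PolySite.incl (P.blockLoc_mono h i)) (a i))) =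
        (P.blockClasses Λ').toList.map fun i => blockVal P ρ i (P.blockLoc_subset_block Λ i) (a i) :=
      List.map_congr_left fun i _ => blockVal_fermionEmbed_incl P ρ i _ _ (a i)
    rw [hw, map_smul, map_smul, map_smul, map_list_prod, hmap, blockExpect_prod P htr Λ' _ (Finset.nodup_toList _) hΛ'l,
      blockExpect_prod P htr Λ _ (Finset.nodup_toList _) hΛl, hval]
  · rw [map_zero, map_zero, map_zero]
  · intro x y _ _ hx hy
    rw [map_add, map_add, hx, hy, map_add]
  · intro c x _ hx
    rw [map_smul, map_smul, hx, map_smul]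

omit htr in
/-- The local functional of positive block states is nonnegative on `Aᴴ A`. [cite: ArakiMoriya2003, §11.1 Theorem 11.2] -/
theorem blockExpect_conjTranspose_mul_self_nonneg (hpsd : ∀ i, (ρ i).PosSemidef) (Λ : Finset (Site d)) (A : FermionOp Λ) :
    0 ≤ blockExpect P ρ hev Λ (Aᴴ * A) := by
  rw [blockExpect_apply, ← Matrix.mul_assoc, Matrix.trace_mul_comm, ← Matrix.mul_assoc]
  exact ((posSemidef_blockDensity P hpsd Λ).mul_mul_conjTranspose_same A).trace_nonneg

end Words

/-! ### §5. The block product state (Araki–Moriya Theorem 11.2 for a partition into finite blocks) -/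

section State

variable {d : ℕ} {ι : Type*} [DecidableEq ι] (P : BlockPartition d ι)
  (ρ : (i : ι) → FermionOp (P.block i)) (hev : ∀ i, parityAut (ρ i) = ρ i) (hpsd : ∀ i, (ρ i).PosSemidef)
  (htr : ∀ i, (ρ i).trace = 1)

namespace InfVolFermionState

/-- **THE BLOCK PRODUCT STATE `⊗_i ρ_i`** (Araki–Moriya 2003, Theorem 11.2, for a partition of `ℤ^d` into finite
blocks): the unique state of the CAR algebra over `ℤ^d` whose marginal on every block `B_i` is the even density matrix
`ρ_i` and which has the product property across blocks. Locally `A ↦ tr(Π_i Γ_i(tr_{Λ∩B_i} ρ_i) · A)`. Instance: the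
periodic product of the Gibbs state of a box over the box tiling of `ℤ^d` (the trial state of the Gibbs variational
principle). [cite: ArakiMoriya2003, §11.1 Theorem 11.2] [cite: BratteliRobinsonII1997, Thm. 6.2.40] -/
def blockProductState : InfVolFermionState d where
  expect := blockExpect P ρ hev
  expect_one Λ := by rw [blockExpect_apply, Matrix.mul_one, trace_blockDensity P htr]
  expect_nonneg Λ A := blockExpect_conjTranspose_mul_self_nonneg P hpsd Λ A
  compatible _ _ h A := blockExpect_fermionEmbed_incl P htr h A

/-- The local expectations of the block product state (definitional). [cite: ArakiMoriya2003, §11.1 Theorem 11.2 eq. (11.6)] -/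
theorem blockProductState_expect (Λ : Finset (Site d)) (A : FermionOp Λ) :
    (blockProductState P ρ hev hpsd htr).expect Λ A = (blockDensity P ρ hev Λ * A).trace := rfl

/-- **The density matrices of the block product state are the local densities**: `ρ_Λ(⊗ρ) = Π_{i ∈ classes Λ} Γ_i(tr_{Λ∩B_i} ρ_i)`.
[cite: ArakiMoriya2003, §11.1 Theorem 11.2 eq. (11.6)] -/
theorem rdm_blockProductState (Λ : Finset (Site d)) : (blockProductState P ρ hev hpsd htr).rdm Λ = blockDensity P ρ hev Λ := by
  refine eq_of_forall_trace_mul_eq fun A => ?_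
  rw [Matrix.trace_mul_comm, InfVolFermionState.trace_rdm_mul, blockProductState_expect, Matrix.trace_mul_comm]

/-- **Product property**: for a duplicate-free list `l` of classes containing those met by `Λ` and observables
`a_i ∈ 𝔄(Λ ∩ B_i)`, `ω(Π_{i ∈ l} Γ_i a_i) = Π_{i ∈ l} tr(Γ a_i · ρ_i)`. [cite: ArakiMoriya2003, §11.1 Theorem 11.2 eq. (11.4)] -/
theorem blockProductState_expect_prod (Λ : Finset (Site d)) (l : List ι) (hl : l.Nodup) (hΛl : ∀ i ∈ P.blockClasses Λ, i ∈ l)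
    (a : (i : ι) → FermionOp (P.blockLoc Λ i)) :
    (blockProductState P ρ hev hpsd htr).expect Λ (l.map fun i => fermionEmbed (P.blockEmb Λ i) (a i)).prod =
      (l.map fun i => blockVal P ρ i (P.blockLoc_subset_block Λ i) (a i)).prod :=
  blockExpect_prod P htr Λ l hl hΛl a

/-- **One part**: `ω(Γ_{Λ∩B_i ⊆ Λ} b) = tr(Γ_{Λ∩B_i ⊆ B_i} b · ρ_i)`. [cite: ArakiMoriya2003, §11.1 Theorem 11.2 eq. (11.4)] -/
theorem blockProductState_expect_fermionEmbed_blockEmb (Λ : Finset (Site d)) (i : ι) (b : FermionOp (P.blockLoc Λ i)) :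
    (blockProductState P ρ hev hpsd htr).expect Λ (fermionEmbed (P.blockEmb Λ i) b) = blockVal P ρ i (P.blockLoc_subset_block Λ i) b := by
  -- the list `i :: (classes Λ ∖ i)` with the observable `b` at `i` and `𝟙` elsewhere
  have hl : (i :: ((P.blockClasses Λ).erase i).toList).Nodup :=
    List.nodup_cons.2 ⟨fun h => Finset.notMem_erase i _ (Finset.mem_toList.1 h), Finset.nodup_toList _⟩
  have hΛl : ∀ j ∈ P.blockClasses Λ, j ∈ i :: ((P.blockClasses Λ).erase i).toList := fun j hj => by
    by_cases hji : j = i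
    · rw [hji]; exact List.mem_cons_self
    · exact List.mem_cons_of_mem _ (Finset.mem_toList.2 (Finset.mem_erase.2 ⟨hji, hj⟩))
  have h := blockProductState_expect_prod P ρ hev hpsd htr Λ _ hl hΛl (fun j => if h : j = i then h ▸ b else 1)
  have hone : ∀ j ∈ ((P.blockClasses Λ).erase i).toList, fermionEmbed (P.blockEmb Λ j) (if h : j = i then h ▸ b else 1) = 1 := by
    intro j hj
    rw [dif_neg (Finset.ne_of_mem_erase (Finset.mem_toList.1 hj)), fermionEmbed_one]
  have hone' : ∀ j ∈ ((P.blockClasses Λ).erase i).toList,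
      blockVal P ρ j (P.blockLoc_subset_block Λ j) (if h : j = i then h ▸ b else 1) = 1 := by
    intro j hj
    rw [dif_neg (Finset.ne_of_mem_erase (Finset.mem_toList.1 hj)), blockVal_one, htr]
  rw [List.map_cons, List.map_cons, List.prod_cons, List.prod_cons, dif_pos rfl,
    List.prod_eq_one (fun x hx => by obtain ⟨j, hj, rfl⟩ := List.mem_map.1 hx; exact hone j hj),
    List.prod_eq_one (fun x hx => by obtain ⟨j, hj, rfl⟩ := List.mem_map.1 hx; exact hone' j hj), mul_one, mul_one] at h
  exact h

/-- **The block product state on an observable of a sub-region of ONE block**: `ω_X(b) = tr(Γ_{X ⊆ B_i} b · ρ_i)` for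
`X ⊆ B_i`. [cite: ArakiMoriya2003, §4.1 Def. 4.5 and §11.1 Theorem 11.2] -/
theorem blockProductState_expect_of_subset_block {X : Finset (Site d)} {i : ι} (hX : X ⊆ P.block i) (b : FermionOp X) :
    (blockProductState P ρ hev hpsd htr).expect X b = blockVal P ρ i hX b := by
  -- `X` is its own class-`i` part
  have hloc : X ⊆ P.blockLoc X i := fun x hx => P.mem_blockLoc.2 ⟨hx, (P.mem_block_iff _ _).1 (hX hx)⟩
  have hemb : fermionEmbed (P.blockEmb X i) (fermionEmbed (PolySite.incl hloc) b) = b := by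
    rw [fermionEmbed_fermionEmbed, PolySite.incl_trans, PolySite.incl_rfl, fermionEmbed_refl_apply]
  conv_lhs => rw [← hemb]
  rw [blockProductState_expect_fermionEmbed_blockEmb, blockVal_fermionEmbed_incl]

/-- **THE MARGINAL ON A BLOCK IS THE BLOCK DENSITY MATRIX**: `(⊗ρ).rdm (B_i) = ρ_i`.
[cite: ArakiMoriya2003, §11.1 Theorem 11.2] -/
theorem rdm_blockProductState_block (i : ι) : (blockProductState P ρ hev hpsd htr).rdm (P.block i) = ρ i := by
  refine eq_of_forall_trace_mul_eq fun A => ?_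
  rw [Matrix.trace_mul_comm, InfVolFermionState.trace_rdm_mul, blockProductState_expect_of_subset_block P ρ hev hpsd htr subset_rfl,
    blockVal_self]

/-- The expectation of an observable of a whole block: `ω_{B_i}(b) = tr(b ρ_i)`. [cite: ArakiMoriya2003, §11.1 Theorem 11.2] -/
theorem blockProductState_expect_block (i : ι) (b : FermionOp (P.block i)) :
    (blockProductState P ρ hev hpsd htr).expect (P.block i) b = (b * ρ i).trace := by
  rw [blockProductState_expect_of_subset_block P ρ hev hpsd htr subset_rfl, blockVal_self]

/-- **The block product state of even block states is even** (Araki–Moriya Thm. 11.2, Remark 2).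
[cite: ArakiMoriya2003, §11.1 Theorem 11.2 Remark 2] -/
theorem blockProductState_isEven : (blockProductState P ρ hev hpsd htr).IsEven := fun Λ A => by
  rw [blockProductState_expect, blockProductState_expect, trace_mul_parityAut, parityAut_blockDensity]

/-- **Uniqueness** (Araki–Moriya Thm. 11.2): a state with the product property on the part-embedded observables IS
the block product state (class-sorted monomials are total). [cite: ArakiMoriya2003, §11.1 Theorem 11.2 ("When such `φ` exists, it is unique")] -/
theorem eq_blockProductState_of_forall_prod {ν : InfVolFermionState d}
    (hν : ∀ (Λ : Finset (Site d)) (l : List ι), l.Nodup → (∀ i ∈ P.blockClasses Λ, i ∈ l) →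
      ∀ a : (i : ι) → FermionOp (P.blockLoc Λ i),
        ν.expect Λ (l.map fun i => fermionEmbed (P.blockEmb Λ i) (a i)).prod =
          (l.map fun i => blockVal P ρ i (P.blockLoc_subset_block Λ i) (a i)).prod) :
    ν = blockProductState P ρ hev hpsd htr := by
  refine InfVolFermionState.ext fun Λ => LinearMap.ext fun A => ?_
  have hA : A ∈ Submodule.span ℂ {M | ∃ w : List (JWLetter (Orb (PolySite Λ))), LettersIn Finset.univ w ∧ wordOp w = M} :=
    mem_span_wordOp_of_mem_carSubalgebra (by rw [carSubalgebra_univ_eq_top]; exact Algebra.mem_top)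
  refine Submodule.span_induction (p := fun A _ => ν.expect Λ A = (blockProductState P ρ hev hpsd htr).expect Λ A) ?_ ?_ ?_ ?_ hA
  · rintro _ ⟨w, -, rfl⟩
    have hsub : ∀ i ∈ P.blockClasses Λ, i ∈ (P.blockClasses Λ).toList := fun i hi => Finset.mem_toList.2 hi
    obtain ⟨n, a, hw⟩ := P.exists_wordOp_eq_sign_smul_prod_fermionEmbed Λ (P.blockClasses Λ).toList (Finset.nodup_toList _)
      (fun x hx => Finset.mem_toList.2 (P.cls_mem_blockClasses hx)) w
    rw [hw, map_smul, map_smul, hν Λ _ (Finset.nodup_toList _) hsub a,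
      blockProductState_expect_prod P ρ hev hpsd htr Λ _ (Finset.nodup_toList _) hsub]
  · rw [map_zero, map_zero]
  · intro x y _ _ hx hy
    rw [map_add, map_add, hx, hy]
  · intro c x _ hx
    rw [map_smul, map_smul, hx]

end InfVolFermionState

end State

end Literature.MathematicalPhysics.QuantumLattice

end
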